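import Mathlib
import Summits.Ventures.PercRepro2.Defs
import Summits.Ventures.PercRepro2.Graph
import Summits.Ventures.PercRepro2.OneColourSwitch
import Summits.Ventures.PercRepro2.RegionHubSign
import Summits.Ventures.PercRepro2.SideSwitch
import Summits.Ventures.PercRepro2.TermSwitchDefs
import Summits.Ventures.PercRepro2.M9NoPocketDefs
import Summits.Ventures.PercRepro2.M9PsiOneDefs

/-!
# The `Y`-world of the partner `Ψ₁ ω` (blind cell PercRepro2, p3 g31, 2026-08-28;
`proofs/P3-PAYMENT.md` §2, claim (i))

For an `EX` colouring `ω` (`IsEX`), the partner `ω' = psiOne ω` has `Y`-world inside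
`Z = {r, s, d} ∪ joinedY ∪ linkSetY ∪ Mcore` (`K2_psiOne_subset`): `Z` is closed under the open
edges of `ω'` (`Zset_closed`), by the colour table of `M9PsiOneDefs` (the colours of `ω'` on the
edge classes: `psiOne_term_Kcore`, `psiOne_term_Mcore`, `psiOne_union_out`, `psiOne_Fnl_out`,
`psiOne_Mcore_out`).  Helpers on the vertex classes (`Fnl`, the joined-or-linking union, `Z`).
The `W`-world and the legality are in `M9PsiOneWorldsM`, the survival of the `Y`-world of `ω`
in `M9PsiOneSurvive`.  Own work; std axioms.
-/

namespace Summit.Ventures.PercRepro2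

namespace NoPocket

open Finset Classical RegionHub OneColourSwitch SideSwitch TermSwitch

variable {V : Type*} {E : Type*}

section Sets

variable (ends : E → Sym2 V) (r s d : V) (ω : Config E)

/-- The `Y`-core vertices neither joined to `d` nor linking (the blocks flipped to the `W`-side
by `Ψ₁`). -/
def Fnl : Set V := {x | x ∈ Kcore ends r s d ω ∧ x ∉ joinedY ends r s d ω ∧ x ∉ linkSetY ends r s d ω}

/-- The candidate `Y`-world of `Ψ₁ ω`: the terminals, `d`, the joined `Y`-blocks, the linking
vertices and the whole `W`-core. -/
def Zset : Set V :=
  ({r, s, d} : Set V) ∪ joinedY ends r s d ω ∪ linkSetY ends r s d ω ∪ Mcore ends r s d ω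

end Sets

section Helpers

variable {ends : E → Sym2 V} {r s d : V} {ω : Config E}

/-- An edge whose ends avoid the joined `Y`-blocks and the linking vertices, and which is not an
edge from `d` into a joined `W`-block, is not kept. -/
lemma not_kept {x y : V} {e : E} (hends : ends e = s(x, y))
    (hx : x ∉ joinedY ends r s d ω ∪ linkSetY ends r s d ω)
    (hy : y ∉ joinedY ends r s d ω ∪ linkSetY ends r s d ω)
    (hxd : x = d → y ∉ joinedW ends r s d ω) (hyd : y = d → x ∉ joinedW ends r s d ω) :
    e ∉ keptEdges ends r s d ω := by
  rintro (⟨a, ha, b, hab⟩ | ⟨z, hz, hz'⟩)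
  · rw [hends, Sym2.eq_iff] at hab
    rcases hab with ⟨rfl, _⟩ | ⟨_, rfl⟩
    · exact hx ha
    · exact hy ha
  · rw [hends, Sym2.eq_iff] at hz'
    rcases hz' with ⟨rfl, rfl⟩ | ⟨rfl, rfl⟩
    · exact hxd rfl hz
    · exact hyd rfl hz

/-- `ends e = s(x, y)` read the other way round. -/
lemma ends_swap {x y : V} {e : E} (hends : ends e = s(x, y)) : ends e = s(y, x) := by
  rw [hends, Sym2.eq_swap]

/-- A `Y`-core vertex adjacent to `d` is joined. -/
lemma mem_joinedY_of_adj_d {x : V} {e : E} (hx : x ∈ Kcore ends r s d ω) (hends : ends e = s(x, d)) :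
    x ∈ joinedY ends r s d ω :=
  mem_joinedY_of_nbr hx (ends_swap hends)

/-- `r` lies in every `Y`-world. -/
lemma r_mem_K2 (ω₀ : Config E) : r ∈ K2 ends r s ω₀ := mem_KH_of_mem (by simp) ω₀

/-- `s` lies in every `Y`-world. -/
lemma s_mem_K2 (ω₀ : Config E) : s ∈ K2 ends r s ω₀ := mem_KH_of_mem (by simp) ω₀

/-- A terminal is not a `Y`-core vertex. -/
lemma term_not_mem_Kcore {t : V} (ht : t = r ∨ t = s) : t ∉ Kcore ends r s d ω := by
  rintro ⟨_, h1, h2, _⟩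
  rcases ht with rfl | rfl
  · exact h1 rfl
  · exact h2 rfl

/-- A terminal is not a `W`-core vertex. -/
lemma term_not_mem_Mcore {t : V} (ht : t = r ∨ t = s) : t ∉ Mcore ends r s d ω := by
  rintro ⟨_, h1, h2, _⟩
  rcases ht with rfl | rfl
  · exact h1 rfl
  · exact h2 rfl

/-- `d` is not a `Y`-core vertex. -/
lemma d_not_mem_Kcore : d ∉ Kcore ends r s d ω := fun h => h.2.2.2 rfl

/-- `d` is not a `W`-core vertex. -/
lemma d_not_mem_Mcore : d ∉ Mcore ends r s d ω := fun h => h.2.2.2 rfl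

/-- A joined-or-linking vertex is a `Y`-core vertex. -/
lemma mem_Kcore_of_mem_union {x : V} (hx : x ∈ joinedY ends r s d ω ∪ linkSetY ends r s d ω) :
    x ∈ Kcore ends r s d ω := by
  rcases hx with hx | hx
  · exact joinedY_subset_Kcore hx
  · exact hx.1

/-- A terminal is neither joined nor linking. -/
lemma term_not_mem_union {t : V} (ht : t = r ∨ t = s) :
    t ∉ joinedY ends r s d ω ∪ linkSetY ends r s d ω :=
  fun h => term_not_mem_Kcore ht (mem_Kcore_of_mem_union h)

/-- `d` is neither joined nor linking. -/
lemma d_not_mem_union : d ∉ joinedY ends r s d ω ∪ linkSetY ends r s d ω :=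
  fun h => d_not_mem_Kcore (mem_Kcore_of_mem_union h)

/-- A `W`-core vertex is neither joined nor linking. -/
lemma Mcore_not_mem_union (hD : DOne ends r s d ω) {x : V} (hx : x ∈ Mcore ends r s d ω) :
    x ∉ joinedY ends r s d ω ∪ linkSetY ends r s d ω :=
  fun h => not_mem_Mcore_of_mem_Kcore hD (mem_Kcore_of_mem_union h) hx

/-- An outside vertex is neither joined nor linking. -/
lemma out_not_mem_union {x : V} (hx : x ∈ Outside ends r s ω) :
    x ∉ joinedY ends r s d ω ∪ linkSetY ends r s d ω :=
  fun h => hx.1 (mem_Kcore_of_mem_union h).1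

/-- A `Y`-core vertex is not in a joined `W`-block. -/
lemma Kcore_not_mem_joinedW (hD : DOne ends r s d ω) {x : V} (hx : x ∈ Kcore ends r s d ω) :
    x ∉ joinedW ends r s d ω :=
  fun h => not_mem_Mcore_of_mem_Kcore hD hx (joinedW_subset_Mcore h)

/-- An outside vertex is not in a joined `W`-block. -/
lemma out_not_mem_joinedW {x : V} (hx : x ∈ Outside ends r s ω) : x ∉ joinedW ends r s d ω :=
  fun h => hx.2 (joinedW_subset_Mcore h).1

/-- A terminal is not in a joined `W`-block. -/
lemma term_not_mem_joinedW {t : V} (ht : t = r ∨ t = s) : t ∉ joinedW ends r s d ω :=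
  fun h => term_not_mem_Mcore ht (joinedW_subset_Mcore h)

/-- A vertex of `Fnl` is neither joined nor linking. -/
lemma not_mem_union_of_mem_Fnl {x : V} (hx : x ∈ Fnl ends r s d ω) :
    x ∉ joinedY ends r s d ω ∪ linkSetY ends r s d ω := by
  rintro (h | h)
  · exact hx.2.1 h
  · exact hx.2.2 h

/-- A `Y`-core vertex is joined, linking, or in `Fnl`. -/
lemma Kcore_cases {x : V} (hx : x ∈ Kcore ends r s d ω) :
    x ∈ joinedY ends r s d ω ∪ linkSetY ends r s d ω ∨ x ∈ Fnl ends r s d ω := by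
  by_cases h1 : x ∈ joinedY ends r s d ω
  · exact Or.inl (Or.inl h1)
  by_cases h2 : x ∈ linkSetY ends r s d ω
  · exact Or.inl (Or.inr h2)
  · exact Or.inr ⟨hx, h1, h2⟩

/-- The `Y`-core neighbour of a joined-or-linking vertex is joined-or-linking. -/
lemma mem_union_of_edge {x y : V} {e : E}
    (hx : x ∈ joinedY ends r s d ω ∪ linkSetY ends r s d ω) (hy : y ∈ Kcore ends r s d ω)
    (hends : ends e = s(x, y)) : y ∈ joinedY ends r s d ω ∪ linkSetY ends r s d ω := by
  rcases hx with hx | hx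
  · exact Or.inl (mem_joinedY_of_edge hx hy hends)
  · exact Or.inr (mem_linkSetY_of_edge hx hy hends)

/-- Membership of a terminal in `Z`. -/
lemma term_mem_Zset {t : V} (ht : t = r ∨ t = s) : t ∈ Zset ends r s d ω := by
  rcases ht with rfl | rfl
  · exact Or.inl (Or.inl (Or.inl (by simp)))
  · exact Or.inl (Or.inl (Or.inl (by simp)))

/-- `d ∈ Z`. -/
lemma d_mem_Zset : d ∈ Zset ends r s d ω := Or.inl (Or.inl (Or.inl (by simp)))

/-- The joined `Y`-blocks and the linking vertices lie in `Z`. -/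
lemma mem_Zset_of_mem_union {x : V} (hx : x ∈ joinedY ends r s d ω ∪ linkSetY ends r s d ω) :
    x ∈ Zset ends r s d ω := by
  rcases hx with hx | hx
  · exact Or.inl (Or.inl (Or.inr hx))
  · exact Or.inl (Or.inr hx)

/-- The `W`-core lies in `Z`. -/
lemma mem_Zset_of_mem_Mcore {x : V} (hx : x ∈ Mcore ends r s d ω) : x ∈ Zset ends r s d ω :=
  Or.inr hx

/-- A terminal lies in `{r, s} ∪ Fnl`. -/
lemma term_mem_Tset {t : V} (ht : t = r ∨ t = s) : t ∈ ({r, s} : Set V) ∪ Fnl ends r s d ω := by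
  rcases ht with rfl | rfl
  · exact Or.inl (by simp)
  · exact Or.inl (by simp)

end Helpers

section Worlds

variable {ends : E → Sym2 V} {p q r s d : V} {ω : Config E}

variable (h : IsEX ends p q r s d ω)
include h

/-- The colour of `Ψ₁ ω` on an edge from a terminal into the `Y`-core: open iff the core end is
joined or linking. -/
lemma psiOne_term_Kcore {t y : V} {e : E} (ht : t = r ∨ t = s) (hy : y ∈ Kcore ends r s d ω)
    (hends : ends e = s(t, y)) :
    psiOne ends r s d ω e = (if y ∈ joinedY ends r s d ω ∪ linkSetY ends r s d ω then true else false) := by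
  have hω : ω e = true := edge_Kcore_term h hy ht (ends_swap hends)
  by_cases hyJ : y ∈ joinedY ends r s d ω ∪ linkSetY ends r s d ω
  · rw [if_pos hyJ, psiOne_of_kept (mem_keptEdges_of_touches hyJ (ends_swap hends)), hω]
  · rw [if_neg hyJ, psiOne_of_not_kept (not_kept hends (term_not_mem_union ht) hyJ
      (fun htd => by rcases ht with rfl | rfl <;> [exact (h.hr htd.symm).elim; exact (h.hs htd.symm).elim])
      (fun hyd => (hy.2.2.2 hyd).elim)), hω]
    rfl

/-- The colour of `Ψ₁ ω` on an edge from a terminal into the `W`-core: open. -/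
lemma psiOne_term_Mcore {t y : V} {e : E} (ht : t = r ∨ t = s) (hy : y ∈ Mcore ends r s d ω)
    (hends : ends e = s(t, y)) : psiOne ends r s d ω e = true := by
  have hω : ω e = false := edge_Mcore_term h hy ht (ends_swap hends)
  rw [psiOne_of_not_kept (not_kept hends (term_not_mem_union ht) (Mcore_not_mem_union h.done hy)
    (fun htd => by rcases ht with rfl | rfl <;> [exact (h.hr htd.symm).elim; exact (h.hs htd.symm).elim])
    (fun hyd => (hy.2.2.2 hyd).elim)), hω]
  rfl

omit h in
/-- The colour of `Ψ₁ ω` on an edge from a joined-or-linking vertex to the outside: closed. -/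
lemma psiOne_union_out {x y : V} {e : E} (hx : x ∈ joinedY ends r s d ω ∪ linkSetY ends r s d ω)
    (hy : y ∈ Outside ends r s ω) (hends : ends e = s(x, y)) : psiOne ends r s d ω e = false := by
  rw [psiOne_of_kept (mem_keptEdges_of_touches hx hends)]
  exact edge_Kcore_out (mem_Kcore_of_mem_union hx) hy hends

/-- The colour of `Ψ₁ ω` on an edge from `Fnl` to the outside: open. -/
lemma psiOne_Fnl_out {x y : V} {e : E} (hx : x ∈ Fnl ends r s d ω) (hy : y ∈ Outside ends r s ω)
    (hends : ends e = s(x, y)) : psiOne ends r s d ω e = true := by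
  rw [psiOne_of_not_kept (not_kept hends (not_mem_union_of_mem_Fnl hx) (out_not_mem_union hy)
    (fun hxd => (hx.1.2.2.2 hxd).elim) (fun hyd => (hy.1 (hyd ▸ h.inK)).elim)),
    edge_Kcore_out hx.1 hy hends]
  rfl

/-- The colour of `Ψ₁ ω` on an edge from the `W`-core to the outside: closed. -/
lemma psiOne_Mcore_out {x y : V} {e : E} (hx : x ∈ Mcore ends r s d ω) (hy : y ∈ Outside ends r s ω)
    (hends : ends e = s(x, y)) : psiOne ends r s d ω e = false := by
  rw [psiOne_of_not_kept (not_kept hends (Mcore_not_mem_union h.done hx) (out_not_mem_union hy)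
    (fun hxd => (d_not_mem_Mcore (hxd ▸ hx)).elim) (fun hyd => (hy.1 (hyd ▸ h.inK)).elim)),
    edge_Mcore_out hx hy hends]
  rfl

/-- **`Z` is closed under the open edges of `Ψ₁ ω`.** -/
lemma Zset_closed :
    ∀ x ∈ Zset ends r s d ω, ∀ y, (openGraph ends (psiOne ends r s d ω)).Adj x y →
      y ∈ Zset ends r s d ω := by
  intro x hx y hxy
  obtain ⟨hne, e, he, hends⟩ := openGraph_adj.1 hxy
  rcases vertex_cases (ends := ends) (r := r) (s := s) (d := d) (ω := ω) y with
    hy | hy | hy | hyK | hyM | hyO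
  · exact hy ▸ term_mem_Zset (Or.inl rfl)
  · exact hy ▸ term_mem_Zset (Or.inr rfl)
  · exact hy ▸ d_mem_Zset
  · rcases Kcore_cases hyK with hyJ | hyF
    · exact mem_Zset_of_mem_union hyJ
    · exfalso
      rcases hx with ((hxT | hxJ) | hxL) | hxM
      · simp only [Set.mem_insert_iff, Set.mem_singleton_iff] at hxT
        rcases hxT with hx | hx | hx
        · rw [psiOne_term_Kcore h (Or.inl hx) hyK hends, if_neg (not_mem_union_of_mem_Fnl hyF)] at he
          exact Bool.false_ne_true he
        · rw [psiOne_term_Kcore h (Or.inr hx) hyK hends, if_neg (not_mem_union_of_mem_Fnl hyF)] at he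
          exact Bool.false_ne_true he
        · exact hyF.2.1 (mem_joinedY_of_nbr hyK (hx ▸ hends))
      · exact hyF.2.1 (mem_joinedY_of_edge hxJ hyK hends)
      · exact hyF.2.2 (mem_linkSetY_of_edge hxL hyK hends)
      · exact no_edge_core_core h hyK hxM (ends_swap hends)
  · exact mem_Zset_of_mem_Mcore hyM
  · exfalso
    rcases hx with ((hxT | hxJ) | hxL) | hxM
    · simp only [Set.mem_insert_iff, Set.mem_singleton_iff] at hxT
      rcases hxT with hx | hx | hx
      · exact no_edge_out_term h hyO (Or.inl hx) hends
      · exact no_edge_out_term h hyO (Or.inr hx) hends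
      · exact no_edge_d_out h hyO (hx ▸ hends)
    · rw [psiOne_union_out (Or.inl hxJ) hyO hends] at he; exact Bool.false_ne_true he
    · rw [psiOne_union_out (Or.inr hxL) hyO hends] at he; exact Bool.false_ne_true he
    · rw [psiOne_Mcore_out h hxM hyO hends] at he; exact Bool.false_ne_true he

/-- **`K₂(Ψ₁ ω) ⊆ Z`.** -/
theorem K2_psiOne_subset : K2 ends r s (psiOne ends r s d ω) ⊆ Zset ends r s d ω := by
  intro x hx
  rcases mem_K2_iff.1 hx with hc | hc
  · exact mem_of_conn_of_closed (Zset_closed h) (term_mem_Zset (Or.inl rfl)) hc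
  · exact mem_of_conn_of_closed (Zset_closed h) (term_mem_Zset (Or.inr rfl)) hc

end Worlds

end NoPocket

end Summit.Ventures.PercRepro2
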